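import Mathlib
import Literature.Probability.LatticeModels.ThermodynamicLimit
import Literature.Probability.LatticeModels.SharpnessProofs
import Summits.CriticalPhenomena.Ising3DConformalLimit.Theorems.PrecisionLaplacianDirectCorrelationStableTailKernelScalingAux
import HarnessLib

/-!
# Helpers (III) for stub `stub_levyContinuityTransfer` of line `diffusive-branch-is-nonsaturation`
(crux `PrecisionLaplacian.DirectCorrelationStableTail`, item stmt-CriticalPhenomena-4799)

**The isotropic `α`-stable Lévy density `|y|₂^{-3-α}` on `ℝ³`** (`0 < α < 2`, `ℝ³ = Fin 3 → ℝ` with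
the product Lebesgue measure, `|y|₂ = √(∑ yᵢ²)`).

* `levyCT_integrable_majorant`: `|y|₂^{-3-α} min(2, |y|₂²)` is integrable (local integrability of
  `‖y‖^{-1-α}` from the landed `kernSc_integral_norm_rpow_ball`, and Mathlib's
  `integrable_one_add_norm` at infinity); consequences `levyCT_integrable_one_sub_cos_mul`
  (`(1 - cos(k·y))|y|₂^{-3-α}` is integrable, via `1 - cos(k·y) ≤ (1+|k|₂²) min(2,|y|₂²)`).
* `levyCT_J_scaling` (registered helper sub-goal `stub_levyContinuityTransfer_auxSymbolScaling`):
  **rotation invariance and scaling** `∫ (1 - cos(k·y))|y|₂^{-3-α} dy = |k|₂^α ∫ (1 - cos y₀)|y|₂^{-3-α} dy`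
  (transport to `EuclideanSpace ℝ (Fin 3)` by the volume-preserving `toLp`; a reflection
  `Submodule.reflection_sub` maps `k/|k|₂` to `e₀`, linear isometries preserve Lebesgue measure
  (`LinearIsometryEquiv.measurePreserving`); then `Measure.integral_comp_smul`);
  `levyCT_J_pos`: the reference integral is positive.
* `levyCT_density_cos_transform`: for a weight `g(y) = ∫ γ(η)(1 - cos(η·y)) dη` (`γ ≥ 0` with
  finite second moment), Fubini gives
  `∫ Φ₀|y|₂^{-3-α} g(y) cos(ξ·y) dy = ∫ γ(η)((Ψ(ξ+η) + Ψ(ξ-η))/2 - Ψ(ξ)) dη`,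
  `Ψ(k) = Φ₀ ∫ (1 - cos(k·y))|y|₂^{-3-α} dy`.

All statements are folklore (the Lévy measure of the rotation invariant stable law: K. Sato, *Lévy
Processes and Infinitely Divisible Distributions* (1999), Thm. 14.14); no definitions are introduced.
-/

noncomputable section

namespace Summit.CriticalPhenomena.Ising3DConformalLimit.Cruxes.DirectCorrelationStableTail.DiffusiveBranchIsNonsaturation

open MeasureTheory Filter Topology
open scoped BigOperators
open Literature.Probability.LatticeModels
open Summit.CriticalPhenomena.Ising3DConformalLimit.Cruxes.DirectCorrelationStableTail.SelfEnergyPickInversion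

/-! ### Elementary pointwise bounds -/

/-- `1 - cos(k·y) ≤ (1 + |k|₂²) · min(2, |y|₂²)` (from `1 - cos t ≤ t²/2`, Cauchy–Schwarz and
`1 - cos t ≤ 2`). [folklore] -/
theorem levyCT_one_sub_cos_le (k y : Fin 3 → ℝ) :
    1 - Real.cos (∑ i, k i * y i) ≤ (1 + ∑ i, k i ^ 2) * min 2 (∑ i, y i ^ 2) := by
  have h2 : 1 - Real.cos (∑ i, k i * y i) ≤ 2 := by
    linarith [Real.neg_one_le_cos (∑ i, k i * y i)]
  have hsq : 1 - Real.cos (∑ i, k i * y i) ≤ (∑ i, k i ^ 2) * (∑ i, y i ^ 2) / 2 := by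
    have h1 := Real.one_sub_sq_div_two_le_cos (x := ∑ i, k i * y i)
    have hcs : (∑ i, k i * y i) ^ 2 ≤ (∑ i, k i ^ 2) * ∑ i, y i ^ 2 :=
      Finset.sum_mul_sq_le_sq_mul_sq _ _ _
    linarith
  have hk : 0 ≤ ∑ i, k i ^ 2 := Finset.sum_nonneg fun i _ => sq_nonneg _
  have hy : 0 ≤ ∑ i, y i ^ 2 := Finset.sum_nonneg fun i _ => sq_nonneg _
  rcases le_total (∑ i, y i ^ 2) 2 with h | h
  · rw [min_eq_right h]
    nlinarith
  · rw [min_eq_left h]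
    nlinarith

/-- The Gaussian-averaged weight `1 - e^{-|y|₂²/2}` is nonnegative. [folklore] -/
theorem levyCT_weight_nonneg (y : Fin 3 → ℝ) :
    0 ≤ 1 - Real.exp (-(1 / 2 * ∑ i, y i ^ 2)) := by
  have hy : 0 ≤ ∑ i, y i ^ 2 := Finset.sum_nonneg fun i _ => sq_nonneg _
  rw [sub_nonneg, Real.exp_le_one_iff]
  nlinarith

/-- The Gaussian-averaged weight is dominated by `min(2, |y|₂²)`. [folklore] -/
theorem levyCT_weight_le (y : Fin 3 → ℝ) :
    1 - Real.exp (-(1 / 2 * ∑ i, y i ^ 2)) ≤ min 2 (∑ i, y i ^ 2) := by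
  have hy : 0 ≤ ∑ i, y i ^ 2 := Finset.sum_nonneg fun i _ => sq_nonneg _
  have h1 := Real.add_one_le_exp (-(1 / 2 * ∑ i, y i ^ 2))
  have h2 := Real.exp_pos (-(1 / 2 * ∑ i, y i ^ 2))
  exact le_min (by linarith) (by linarith)

/-! ### The integrable majorant `|y|₂^{-3-α} min(2, |y|₂²)` -/

/-- **Basic integrable majorant.** For `0 < α < 2`, `y ↦ |y|₂^{-3-α} min(2, |y|₂²)` is integrable
on `ℝ³`: near the origin it is `|y|₂^{-1-α}` (locally integrable as `-1-α > -3`), at infinity it is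
`2|y|₂^{-3-α}` (integrable as `3 + α > 3`). [folklore] -/
theorem levyCT_integrable_majorant {α : ℝ} (hα0 : 0 < α) (hα2 : α < 2) :
    Integrable (fun y : Fin 3 → ℝ => √(∑ i, y i ^ 2) ^ (-(3 + α)) * min 2 (∑ i, y i ^ 2)) := by
  have hball := (kernSc_integral_norm_rpow_ball (β := -1 - α) (by linarith) one_pos).1
  have hfar : Integrable (fun y : Fin 3 → ℝ => (1 + ‖y‖) ^ (-(3 + α))) := by
    apply integrable_one_add_norm
    rw [Module.finrank_fin_fun]
    push_cast
    linarith
  refine Integrable.mono' (hball.add (hfar.const_mul (2 * 2 ^ (3 + α))))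
    ((kernSc_measurable_euclid_rpow _).aestronglyMeasurable.mul
      (by fun_prop : Continuous fun y : Fin 3 → ℝ => min 2 (∑ i, y i ^ 2)).aestronglyMeasurable)
    (ae_of_all _ fun y => ?_)
  have hS0 : 0 ≤ ∑ i, y i ^ 2 := Finset.sum_nonneg fun i _ => sq_nonneg _
  have hK0 : 0 ≤ √(∑ i, y i ^ 2) ^ (-(3 + α)) := Real.rpow_nonneg (Real.sqrt_nonneg _) _
  have hmin0 : 0 ≤ min 2 (∑ i, y i ^ 2) := le_min zero_le_two hS0
  rw [Real.norm_eq_abs, abs_of_nonneg (mul_nonneg hK0 hmin0), Pi.add_apply]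
  have hfar0 : 0 ≤ 2 * 2 ^ (3 + α) * (1 + ‖y‖) ^ (-(3 + α)) := by positivity
  have hind0 : 0 ≤ (Metric.closedBall (0 : Fin 3 → ℝ) 1).indicator (fun v => ‖v‖ ^ (-1 - α)) y :=
    Set.indicator_nonneg (fun v _ => Real.rpow_nonneg (norm_nonneg v) _) y
  by_cases hy0 : y = 0
  · subst hy0
    have : √(∑ i : Fin 3, (0 : Fin 3 → ℝ) i ^ 2) ^ (-(3 + α)) = 0 := by
      simp only [Pi.zero_apply, ne_eq, OfNat.ofNat_ne_zero, not_false_eq_true, zero_pow,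
        Finset.sum_const_zero, Real.sqrt_zero]
      exact Real.zero_rpow (show (-(3 + α) : ℝ) ≠ 0 by linarith)
    rw [this, zero_mul]
    exact add_nonneg hind0 hfar0
  have hnpos : 0 < ‖y‖ := norm_pos_iff.2 hy0
  have hsqrt : ‖y‖ ≤ √(∑ i, y i ^ 2) := norm_le_sqrt_sum_sq y
  have hsqrt_pos : 0 < √(∑ i, y i ^ 2) := hnpos.trans_le hsqrt
  by_cases hy : ‖y‖ ≤ 1
  · rw [Set.indicator_of_mem (mem_closedBall_zero_iff.2 hy)]
    have h1 : √(∑ i, y i ^ 2) ^ (-(3 + α)) * min 2 (∑ i, y i ^ 2) ≤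
        √(∑ i, y i ^ 2) ^ (-(3 + α)) * ∑ i, y i ^ 2 :=
      mul_le_mul_of_nonneg_left (min_le_right _ _) hK0
    have h2 : √(∑ i, y i ^ 2) ^ (-(3 + α)) * (∑ i, y i ^ 2) = √(∑ i, y i ^ 2) ^ (-1 - α) := by
      have e : (∑ i, y i ^ 2) = √(∑ i, y i ^ 2) ^ (2 : ℝ) := by
        rw [Real.rpow_two, Real.sq_sqrt hS0]
      calc √(∑ i, y i ^ 2) ^ (-(3 + α)) * (∑ i, y i ^ 2)
          = √(∑ i, y i ^ 2) ^ (-(3 + α)) * √(∑ i, y i ^ 2) ^ (2 : ℝ) := by rw [← e]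
        _ = √(∑ i, y i ^ 2) ^ (-(3 + α) + 2) := by rw [← Real.rpow_add hsqrt_pos]
        _ = √(∑ i, y i ^ 2) ^ (-1 - α) := by ring_nf
    have h3 : √(∑ i, y i ^ 2) ^ (-1 - α) ≤ ‖y‖ ^ (-1 - α) :=
      Real.rpow_le_rpow_of_nonpos hnpos hsqrt (by linarith)
    linarith
  · push Not at hy
    rw [Set.indicator_of_notMem (fun h => (not_le.2 hy) (mem_closedBall_zero_iff.1 h)), zero_add]
    have h1 : √(∑ i, y i ^ 2) ^ (-(3 + α)) * min 2 (∑ i, y i ^ 2) ≤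
        √(∑ i, y i ^ 2) ^ (-(3 + α)) * 2 :=
      mul_le_mul_of_nonneg_left (min_le_left _ _) hK0
    have h2 : √(∑ i, y i ^ 2) ^ (-(3 + α)) ≤ ‖y‖ ^ (-(3 + α)) :=
      Real.rpow_le_rpow_of_nonpos hnpos hsqrt (by linarith)
    have h3 : ‖y‖ ^ (-(3 + α)) ≤ 2 ^ (3 + α) * (1 + ‖y‖) ^ (-(3 + α)) := by
      have h4 : (1 + ‖y‖) / 2 ≤ ‖y‖ := by linarith
      have h5 : ‖y‖ ^ (-(3 + α)) ≤ ((1 + ‖y‖) / 2) ^ (-(3 + α)) :=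
        Real.rpow_le_rpow_of_nonpos (by positivity) h4 (by linarith)
      have h6 : ((1 + ‖y‖) / 2) ^ (-(3 + α)) = 2 ^ (3 + α) * (1 + ‖y‖) ^ (-(3 + α)) := by
        rw [Real.div_rpow (by positivity) (by norm_num), Real.rpow_neg (by norm_num : (0:ℝ) ≤ 2),
          div_eq_mul_inv, inv_inv, mul_comm]
      linarith [h6 ▸ h5]
    nlinarith [Real.rpow_nonneg (norm_nonneg y) (-(3 + α))]

/-- Integrability of `(1 - cos(k·y)) |y|₂^{-3-α}` on `ℝ³` for `0 < α < 2`. [folklore] -/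
theorem levyCT_integrable_one_sub_cos_mul {α : ℝ} (hα0 : 0 < α) (hα2 : α < 2)
    (k : Fin 3 → ℝ) :
    Integrable (fun y : Fin 3 → ℝ =>
      (1 - Real.cos (∑ i, k i * y i)) * √(∑ i, y i ^ 2) ^ (-(3 + α))) := by
  refine ((levyCT_integrable_majorant hα0 hα2).const_mul (1 + ∑ i, k i ^ 2)).mono'
    ((by fun_prop : Continuous fun y : Fin 3 → ℝ =>
        1 - Real.cos (∑ i, k i * y i)).aestronglyMeasurable.mul
      (kernSc_measurable_euclid_rpow _).aestronglyMeasurable)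
    (ae_of_all _ fun y => ?_)
  have hK0 : 0 ≤ √(∑ i, y i ^ 2) ^ (-(3 + α)) := Real.rpow_nonneg (Real.sqrt_nonneg _) _
  have hc0 : 0 ≤ 1 - Real.cos (∑ i, k i * y i) := by linarith [Real.cos_le_one (∑ i, k i * y i)]
  rw [Real.norm_eq_abs, abs_of_nonneg (mul_nonneg hc0 hK0)]
  calc (1 - Real.cos (∑ i, k i * y i)) * √(∑ i, y i ^ 2) ^ (-(3 + α))
      ≤ ((1 + ∑ i, k i ^ 2) * min 2 (∑ i, y i ^ 2)) * √(∑ i, y i ^ 2) ^ (-(3 + α)) :=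
        mul_le_mul_of_nonneg_right (levyCT_one_sub_cos_le k y) hK0
    _ = (1 + ∑ i, k i ^ 2) * (√(∑ i, y i ^ 2) ^ (-(3 + α)) * min 2 (∑ i, y i ^ 2)) := by ring


/-! ### Rotation and scaling: `J(k) = |k|₂^α · J(e₀)` -/

/-- Transport of a Lebesgue integral on `Fin 3 → ℝ` to `EuclideanSpace ℝ (Fin 3)` (the identity
map `toLp` is volume preserving). [folklore] -/
theorem levyCT_integral_toLp (F : EuclideanSpace ℝ (Fin 3) → ℝ) :
    ∫ y : Fin 3 → ℝ, F (WithLp.toLp 2 y) = ∫ u : EuclideanSpace ℝ (Fin 3), F u :=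
  (PiLp.volume_preserving_toLp (Fin 3)).integral_comp
    (MeasurableEquiv.toLp 2 (Fin 3 → ℝ)).measurableEmbedding F

/-- **Rotation invariance and scaling of the Lévy symbol integral.**  For `α > 0` and every
`k ∈ ℝ³`, `∫ (1 - cos(k·y)) |y|₂^{-3-α} dy = |k|₂^α ∫ (1 - cos(y₀)) |y|₂^{-3-α} dy`
(both sides vanish if the integrals diverge).  Proof: on Euclidean space, a reflection maps
`k/|k|₂` to the first basis vector (Lebesgue measure is invariant under linear isometries,
`LinearIsometryEquiv.measurePreserving`), and the substitution `y ↦ y/|k|₂`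
(`Measure.integral_comp_smul`) produces the factor `|k|₂^{3+α-3}`. [folklore] -/
theorem levyCT_J_scaling {α : ℝ} (hα : 0 < α) (k : Fin 3 → ℝ) :
    ∫ y : Fin 3 → ℝ, (1 - Real.cos (∑ i, k i * y i)) * √(∑ i, y i ^ 2) ^ (-(3 + α)) =
      √(∑ i, k i ^ 2) ^ α *
        ∫ y : Fin 3 → ℝ, (1 - Real.cos (y 0)) * √(∑ i, y i ^ 2) ^ (-(3 + α)) := by
  by_cases hk : k = 0
  · subst hk
    simp [Real.zero_rpow hα.ne']
  set κ : EuclideanSpace ℝ (Fin 3) := WithLp.toLp 2 k with hκ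
  have hκ0 : κ ≠ 0 := by simpa [hκ] using hk
  have hnormκ : ‖κ‖ = √(∑ i, k i ^ 2) := (kernSc_euclid_eq_norm_toLp k).symm
  have htpos : 0 < ‖κ‖ := norm_pos_iff.2 hκ0
  set G : EuclideanSpace ℝ (Fin 3) → ℝ :=
    fun u => (1 - Real.cos (u 0)) * ‖u‖ ^ (-(3 + α)) with hG
  have hL : (∫ y : Fin 3 → ℝ, (1 - Real.cos (∑ i, k i * y i)) * √(∑ i, y i ^ 2) ^ (-(3 + α))) =
      ∫ u : EuclideanSpace ℝ (Fin 3), (1 - Real.cos (inner ℝ κ u)) * ‖u‖ ^ (-(3 + α)) := by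
    rw [← levyCT_integral_toLp]
    refine integral_congr_ae (ae_of_all _ fun y => ?_)
    simp only
    rw [kernSc_euclid_eq_norm_toLp y]
    simp [hκ, PiLp.inner_apply, mul_comm]
  have hR : (∫ y : Fin 3 → ℝ, (1 - Real.cos (y 0)) * √(∑ i, y i ^ 2) ^ (-(3 + α))) =
      ∫ u : EuclideanSpace ℝ (Fin 3), G u := by
    rw [← levyCT_integral_toLp]
    refine integral_congr_ae (ae_of_all _ fun y => ?_)
    simp only [hG]
    rw [kernSc_euclid_eq_norm_toLp y]
  rw [hL, hR]
  -- rotation: a reflection mapping `κ/‖κ‖` to `e₀`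
  set e₀ : EuclideanSpace ℝ (Fin 3) := EuclideanSpace.single 0 1 with he₀
  set a : EuclideanSpace ℝ (Fin 3) := ‖κ‖⁻¹ • κ with ha
  have ha1 : ‖a‖ = ‖e₀‖ := by
    rw [ha, he₀, PiLp.norm_single, norm_smul, norm_inv, norm_norm,
      inv_mul_cancel₀ htpos.ne', norm_one]
  set O : EuclideanSpace ℝ (Fin 3) ≃ₗᵢ[ℝ] EuclideanSpace ℝ (Fin 3) :=
    Submodule.reflection (ℝ ∙ (a - e₀))ᗮ with hO
  have hOa : O a = e₀ := Submodule.reflection_sub ha1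
  have hOκ : O κ = ‖κ‖ • e₀ := by
    have : κ = ‖κ‖ • a := by rw [ha, smul_smul, mul_inv_cancel₀ htpos.ne', one_smul]
    conv_lhs => rw [this]
    rw [LinearIsometryEquiv.map_smul, hOa]
  have hemb : MeasurableEmbedding (O.symm : EuclideanSpace ℝ (Fin 3) → EuclideanSpace ℝ (Fin 3)) :=
    O.symm.toHomeomorph.measurableEmbedding
  have hrot : (∫ u : EuclideanSpace ℝ (Fin 3), (1 - Real.cos (inner ℝ κ u)) * ‖u‖ ^ (-(3 + α))) =
      ∫ w : EuclideanSpace ℝ (Fin 3), (1 - Real.cos (‖κ‖ * w 0)) * ‖w‖ ^ (-(3 + α)) := by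
    rw [← O.symm.measurePreserving.integral_comp hemb]
    refine integral_congr_ae (ae_of_all _ fun w => ?_)
    simp only
    have h1 : inner ℝ κ (O.symm w) = ‖κ‖ * w 0 := by
      rw [← O.inner_map_map, O.apply_symm_apply, hOκ, real_inner_smul_left, he₀,
        EuclideanSpace.inner_single_left]
      simp
    rw [h1, LinearIsometryEquiv.norm_map]
  rw [hrot]
  -- scaling `w ↦ ‖κ‖ • w`
  have hscale := Measure.integral_comp_smul (volume : Measure (EuclideanSpace ℝ (Fin 3))) G ‖κ‖
  have hGt : ∀ w : EuclideanSpace ℝ (Fin 3), G (‖κ‖ • w) =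
      ‖κ‖ ^ (-(3 + α)) * ((1 - Real.cos (‖κ‖ * w 0)) * ‖w‖ ^ (-(3 + α))) := by
    intro w
    simp only [hG, PiLp.smul_apply, smul_eq_mul, norm_smul, Real.norm_eq_abs, abs_of_pos htpos]
    rw [Real.mul_rpow htpos.le (norm_nonneg _)]
    ring
  simp_rw [hGt] at hscale
  rw [integral_const_mul, finrank_euclideanSpace_fin] at hscale
  have ht3 : |(‖κ‖ ^ 3)⁻¹| = ‖κ‖ ^ (-(3 : ℝ)) := by
    rw [abs_of_pos (by positivity), Real.rpow_neg htpos.le]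
    norm_cast
  rw [ht3, smul_eq_mul] at hscale
  have hsplit : ‖κ‖ ^ α = ‖κ‖ ^ (3 + α) * ‖κ‖ ^ (-(3 : ℝ)) := by
    rw [← Real.rpow_add htpos]
    ring_nf
  calc (∫ w : EuclideanSpace ℝ (Fin 3), (1 - Real.cos (‖κ‖ * w 0)) * ‖w‖ ^ (-(3 + α)))
      = ‖κ‖ ^ (3 + α) * (‖κ‖ ^ (-(3 + α)) *
          ∫ w : EuclideanSpace ℝ (Fin 3), (1 - Real.cos (‖κ‖ * w 0)) * ‖w‖ ^ (-(3 + α))) := by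
        rw [← mul_assoc, ← Real.rpow_add htpos]
        simp
    _ = ‖κ‖ ^ (3 + α) * (‖κ‖ ^ (-(3 : ℝ)) * ∫ u, G u) := by rw [hscale]
    _ = √(∑ i, k i ^ 2) ^ α * ∫ u, G u := by rw [← mul_assoc, ← hsplit, hnormκ]


/-- A nonnegative integrable function on `ℝ³` which is positive on the open box `(1,2)³` has
positive integral. [folklore] -/
theorem levyCT_integral_pos_of_pos_on_box (F : (Fin 3 → ℝ) → ℝ) (hF0 : ∀ y, 0 ≤ F y)
    (hFi : Integrable F) (hpos : ∀ y : Fin 3 → ℝ, (∀ i, 1 < y i ∧ y i < 2) → 0 < F y) :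
    0 < ∫ y, F y := by
  rw [integral_pos_iff_support_of_nonneg hF0 hFi]
  set U : Set (Fin 3 → ℝ) := Set.pi Set.univ (fun _ => Set.Ioo 1 2) with hU
  have hUopen : IsOpen U := isOpen_set_pi Set.finite_univ (fun _ _ => isOpen_Ioo)
  have hUne : U.Nonempty := ⟨fun _ => 3 / 2, fun i _ => ⟨by norm_num, by norm_num⟩⟩
  refine (hUopen.measure_pos volume hUne).trans_le (measure_mono fun y hy => ?_)
  rw [Function.mem_support]
  exact (hpos y fun i => hy i (Set.mem_univ i)).ne'

/-- **Positivity of the reference symbol integral** `J(e₀) = ∫ (1 - cos y₀) |y|₂^{-3-α} dy > 0`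
(`0 < α < 2`): the integrand is nonnegative, integrable, and positive on the open box
`(1,2)³`. [folklore] -/
theorem levyCT_J_pos {α : ℝ} (hα0 : 0 < α) (hα2 : α < 2) :
    0 < ∫ y : Fin 3 → ℝ, (1 - Real.cos (y 0)) * √(∑ i, y i ^ 2) ^ (-(3 + α)) := by
  have hint : Integrable
      (fun y : Fin 3 → ℝ => (1 - Real.cos (y 0)) * √(∑ i, y i ^ 2) ^ (-(3 + α))) := by
    have h := levyCT_integrable_one_sub_cos_mul hα0 hα2 (Pi.single 0 1)
    refine h.congr (ae_of_all _ fun y => ?_)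
    simp [Fin.sum_univ_three]
  refine levyCT_integral_pos_of_pos_on_box _ (fun y => mul_nonneg
    (by linarith [Real.cos_le_one (y 0)]) (Real.rpow_nonneg (Real.sqrt_nonneg _) _)) hint
    fun y hy => ?_
  have h0 : 1 < y 0 ∧ y 0 < 2 := hy 0
  have hcos : Real.cos (y 0) < 1 := by
    have hne : Real.cos (y 0) ≠ 1 := by
      rw [Ne, Real.cos_eq_one_iff_of_lt_of_lt (by linarith [Real.pi_gt_three])
        (by linarith [Real.pi_gt_three])]
      exact fun h => by linarith
    exact lt_of_le_of_ne (Real.cos_le_one _) hne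
  have hpos : 0 < √(∑ i, y i ^ 2) := by
    apply Real.sqrt_pos.2
    have h1 : 0 < y 0 ^ 2 := by nlinarith
    exact h1.trans_le (Finset.single_le_sum (fun i _ => sq_nonneg (y i)) (Finset.mem_univ 0))
  exact mul_pos (by linarith) (Real.rpow_pos_of_pos hpos _)

/-! ### The cosine transform of the stable density with Gaussian-averaged weight -/

/-- The trigonometric identity behind the polarisation of the symbol:
`cos a · (1 - cos b) = ((1 - cos(a+b)) + (1 - cos(a-b)))/2 - (1 - cos a)`. [folklore] -/
theorem levyCT_cos_mul_one_sub_cos (a b : ℝ) :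
    Real.cos a * (1 - Real.cos b) =
      ((1 - Real.cos (a + b)) + (1 - Real.cos (a - b))) / 2 - (1 - Real.cos a) := by
  rw [Real.cos_add, Real.cos_sub]
  ring

/-- **Cosine transform of the stable density with Gaussian-averaged weight (Fubini).**
Let `γ ≥ 0` be continuous with `(1 + |η|₂²) γ(η)` integrable and `g(y) = ∫ γ(η)(1 - cos(η·y)) dη`.
Then for `0 < α < 2`, with `Ψ(k) = Φ₀ ∫ (1 - cos(k·y)) |y|₂^{-3-α} dy`,
`∫ Φ₀ |y|₂^{-3-α} g(y) cos(ξ·y) dy = ∫ γ(η) ((Ψ(ξ+η) + Ψ(ξ-η))/2 - Ψ(ξ)) dη`. [folklore] -/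
theorem levyCT_density_cos_transform {α : ℝ} (Φ₀ : ℝ) (hα0 : 0 < α) (hα2 : α < 2)
    (γ : (Fin 3 → ℝ) → ℝ) (hγc : Continuous γ) (hγ0 : ∀ η, 0 ≤ γ η)
    (hγi : Integrable (fun η : Fin 3 → ℝ => (1 + ∑ i, η i ^ 2) * γ η))
    (g : (Fin 3 → ℝ) → ℝ) (hg : ∀ u, g u = ∫ η, γ η * (1 - Real.cos (∑ i, η i * u i)))
    (Ψ : (Fin 3 → ℝ) → ℝ)
    (hΨ : ∀ k, Ψ k = Φ₀ * ∫ y : Fin 3 → ℝ,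
      (1 - Real.cos (∑ i, k i * y i)) * √(∑ i, y i ^ 2) ^ (-(3 + α)))
    (ξ : Fin 3 → ℝ) :
    ∫ y : Fin 3 → ℝ, Φ₀ * √(∑ i, y i ^ 2) ^ (-(3 + α)) * g y * Real.cos (∑ j, ξ j * y j) =
      ∫ η, γ η * ((Ψ (ξ + η) + Ψ (ξ - η)) / 2 - Ψ ξ) := by
  set K : (Fin 3 → ℝ) → ℝ := fun y => √(∑ i, y i ^ 2) ^ (-(3 + α)) with hK
  have hKm : Measurable K := kernSc_measurable_euclid_rpow _
  have hK0 : ∀ y, 0 ≤ K y := fun y => Real.rpow_nonneg (Real.sqrt_nonneg _) _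
  set F : (Fin 3 → ℝ) → (Fin 3 → ℝ) → ℝ := fun y η =>
    γ η * (Φ₀ * K y * Real.cos (∑ j, ξ j * y j) * (1 - Real.cos (∑ i, η i * y i))) with hF
  -- Step 1: the integrand is an inner integral
  have h1 : ∀ y, Φ₀ * K y * g y * Real.cos (∑ j, ξ j * y j) = ∫ η, F y η := by
    intro y
    rw [hg y, mul_comm (Φ₀ * K y) (∫ η, _), mul_assoc, ← integral_mul_const]
    refine integral_congr_ae (ae_of_all _ fun η => ?_)
    simp only [hF]
    ring
  simp_rw [show ∀ y, √(∑ i, y i ^ 2) ^ (-(3 + α)) = K y from fun y => rfl, h1]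
  -- Step 2: integrability on the product space
  have hprod : Integrable (Function.uncurry F) ((volume : Measure (Fin 3 → ℝ)).prod volume) := by
    have hdom := ((levyCT_integrable_majorant hα0 hα2).const_mul |Φ₀|).mul_prod hγi
    refine hdom.mono' ?_ (ae_of_all _ fun z => ?_)
    · have hm : Measurable (Function.uncurry F) := by
        refine (hγc.measurable.comp measurable_snd).mul
          ((((measurable_const.mul (hKm.comp measurable_fst)).mul ?_)).mul ?_)
        · exact (by fun_prop : Continuous fun z : (Fin 3 → ℝ) × (Fin 3 → ℝ) =>
            Real.cos (∑ j, ξ j * z.1 j)).measurable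
        · exact (by fun_prop : Continuous fun z : (Fin 3 → ℝ) × (Fin 3 → ℝ) =>
            1 - Real.cos (∑ i, z.2 i * z.1 i)).measurable
      exact hm.aestronglyMeasurable
    · rcases z with ⟨y, η⟩
      simp only [Function.uncurry_apply_pair, hF]
      have hc0 : 0 ≤ 1 - Real.cos (∑ i, η i * y i) := by
        linarith [Real.cos_le_one (∑ i, η i * y i)]
      have hb := levyCT_one_sub_cos_le η y
      have hcos1 : |Real.cos (∑ j, ξ j * y j)| ≤ 1 := Real.abs_cos_le_one _
      rw [Real.norm_eq_abs]
      simp only [abs_mul, abs_of_nonneg (hγ0 η), abs_of_nonneg (hK0 y), abs_of_nonneg hc0]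
      have hmin0 : 0 ≤ min 2 (∑ i, y i ^ 2) :=
        le_min zero_le_two (Finset.sum_nonneg fun i _ => sq_nonneg _)
      have hη0 : 0 ≤ 1 + ∑ i, η i ^ 2 := by positivity
      calc γ η * (|Φ₀| * K y * |Real.cos (∑ j, ξ j * y j)| * (1 - Real.cos (∑ i, η i * y i)))
          ≤ γ η * (|Φ₀| * K y * 1 * ((1 + ∑ i, η i ^ 2) * min 2 (∑ i, y i ^ 2))) := by
            gcongr
            exact hγ0 η
        _ = |Φ₀| * (K y * min 2 (∑ i, y i ^ 2)) * ((1 + ∑ i, η i ^ 2) * γ η) := by ring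
  -- Step 3: Fubini
  rw [integral_integral_swap hprod]
  -- Step 4: the inner `y`-integral
  refine integral_congr_ae (ae_of_all _ fun η => ?_)
  have hI := fun k => levyCT_integrable_one_sub_cos_mul hα0 hα2 k
  have hpt : ∀ y, F y η = γ η * Φ₀ *
      ((((1 - Real.cos (∑ i, (ξ + η) i * y i)) * K y +
          (1 - Real.cos (∑ i, (ξ - η) i * y i)) * K y) / 2) -
        (1 - Real.cos (∑ i, ξ i * y i)) * K y) := by
    intro y
    simp only [hF, Pi.add_apply, Pi.sub_apply, add_mul, sub_mul, Finset.sum_add_distrib,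
      Finset.sum_sub_distrib]
    rw [show γ η * (Φ₀ * K y * Real.cos (∑ j, ξ j * y j) * (1 - Real.cos (∑ i, η i * y i))) =
      γ η * Φ₀ * K y * (Real.cos (∑ j, ξ j * y j) * (1 - Real.cos (∑ i, η i * y i))) by ring,
      levyCT_cos_mul_one_sub_cos]
    ring
  simp_rw [hpt]
  rw [integral_const_mul, integral_sub, integral_div, integral_add (hI _) (hI _)]
  · rw [hΨ, hΨ, hΨ]
    ring
  · exact ((hI _).add (hI _)).div_const _
  · exact hI _

/-- **Registered helper sub-goal `stub_levyContinuityTransfer_auxSymbolScaling`** of stub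
`stub_levyContinuityTransfer` (line `diffusive-branch-is-nonsaturation`, crux
stmt-CriticalPhenomena-4799): rotation invariance and scaling of the Lévy symbol integral,
`∫ (1 - cos(k·y))|y|₂^{-3-α} dy = |k|₂^α ∫ (1 - cos y₀)|y|₂^{-3-α} dy` for `α > 0`. [folklore] -/
theorem stub_levyContinuityTransfer_auxSymbolScaling :
    ∀ (α : ℝ), 0 < α → ∀ k : Fin 3 → ℝ,
      ∫ y : Fin 3 → ℝ, (1 - Real.cos (∑ i, k i * y i)) * Real.sqrt (∑ i, y i ^ 2) ^ (-(3 + α)) =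
        Real.sqrt (∑ i, k i ^ 2) ^ α *
          ∫ y : Fin 3 → ℝ, (1 - Real.cos (y 0)) * Real.sqrt (∑ i, y i ^ 2) ^ (-(3 + α)) :=
  fun _ hα k => levyCT_J_scaling hα k

end Summit.CriticalPhenomena.Ising3DConformalLimit.Cruxes.DirectCorrelationStableTail.DiffusiveBranchIsNonsaturation

end
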